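import Literature.AnabelianGeometry.EtaleTheta.SettingModelTateCyclotomes
import Literature.AnabelianGeometry.EtaleTheta.SettingModelTateThetaCusp
import HarnessLib

/-!
# The stage-2 («Tate shear») root model WITH A CUSP (R78 F5qc `ThetaSetting.modelχq′`), row #5: the cyclotome
# identifications `μ_N ≅ (l·Δ_Θ) ⊗ ℤ/Nℤ`, a `CyclotomeTower`, and `IsCompact Δ_Θ` — transported VERBATIM from `modelχq`

Mochizuki, *The Étale Theta Function …* [EtTh], Publ. RIMS **45** (2009), §1 p. 12 «(`Ẑ(1) ≅`) `Δ_Θ`», §2 p. 46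
«the natural isomorphism `μ_N ≅ (l·Δ_Θ) ⊗ (ℤ/Nℤ)`», Cor. 2.19 (ii) p. 64 (PRIMS PDF pages) [cite: MochizukiEtTh2009, §2 p.46].
Cell abc-iut, layer L2, R78 cluster STAGE 2, seat abc-iut-w5-d029 (gen 5) at abc-iut-L2-t8 g5's request (10:23:46Z: «the
cusped twin of p437770 … take it with your record»).  PROOF-ONLY (0 definitions, 0 instances): the stage-2 clone of
abc-iut-L2-t8's `SettingModelChiCuspCyclotomes` (p435011).

This seat's `ThetaSetting.modelχq′ p i j hj` (`SettingModelTateThetaCusp`, F5qc) is abc-iut-L2-t5's `modelχq p i j hj`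
(F5q, p437247) transcribed over `curveχq′` = the SAME `Π^tp_X = Γ ⋊_{actχq} G_{ℚ_p}`, `aug`, `Π_X`, theta quotients
(abc-iut-L2-d1's `CurveTheta` package; `thetaKer_curveχq'_eq : … = … := rfl`) plus ONE synthetic cusp.  Hence every
row-#5 result of abc-iut-L2-t8 at `modelχq` (`SettingModelTateCyclotomes`, p437770, over abc-iut-L6-d6's `Ẑ`-coordinates
`deltaThetaCoordχq` p433817) holds at `modelχq′` — the topological facts BY DEFINITIONAL TRANSPORT, the `D`-indexed
structures by re-running the row-#5 engine on the same coordinates: `t2Space_deltaTheta_modelχq'`,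
`isCompact_deltaTheta_modelχq'`, `modelχq'_exists_cyclotomeMod_family` (abc-iut-L2-t8's χ-law `conjNormal_toTheta_deltaThetaCoordχq` passed as a lambda — no instance search on mixed carriers),
`modelχq'_nonempty_cyclotomeMod`, `modelχq'_nonempty_cyclotomeTower`, and the joint-satisfiability capstone OVER THE
CUSPED STAGE-2 CARRIER: `exists_curveχq'_isEtThOrigin_and_isCusp_and_hYcl_and_isCompact_and_cyclotomeTower` — for every
`i` and every even `j`, one theta setting over `curveχq′ p i j` with the guard, a cusp, `hYcl`, `IsCompact Δ_Θ`, `aug` open,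
`CyclotomeMod l N` at every level and a `CyclotomeTower l E` over every cofinal chain.  HONEST LABEL: semi-synthetic model
(the cusp is the Tate-twisted `b`-axis) — consistency evidence for the typed interface; nothing of [EtTh] asserted; no
side taken on [IUTchIII] Cor. 3.12; typed ≠ endorsed.
-/

noncomputable section

namespace Literature.AnabelianGeometry.EtaleTheta.SettingModel

open Literature.AnabelianGeometry.SemiGraphs

variable (p : ℕ) [Fact p.Prime]

section
variable (i j : ℤ) (hj : Even j)

/-- `Δ_Θ` of `modelχq′` is Hausdorff (same theta quotient as `modelχq`). [cite: MochizukiEtTh2009, §1 p.12] -/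
theorem t2Space_deltaTheta_modelχq' : T2Space ↥(ThetaSetting.modelχq' p i j hj).DeltaTheta :=
  t2Space_deltaTheta_modelχq p i j hj

/-- **`Δ_Θ` of `modelχq′` is COMPACT** (GAP G-w5d187-1's binder at the cusped stage-2 model).
[cite: MochizukiEtTh2009, §1 p.12] -/
theorem isCompact_deltaTheta_modelχq' :
    IsCompact ((ThetaSetting.modelχq' p i j hj).DeltaTheta : Set (ThetaSetting.modelχq' p i j hj).GtpTheta) :=
  isCompact_deltaTheta_modelχq p i j hj

/-- **`μ_N ≅ (l·Δ_Θ) ⊗ ℤ/Nℤ` at ALL levels, compatibly, at `modelχq′`** (`l ≥ 1`; the row-#5 engine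
`exists_cyclotomeMod_family_of_chiTwist_inv` run at `modelχq′` on the same coordinates `deltaThetaCoordχq`).
[cite: MochizukiEtTh2009, Def 2.13 (ii) p.48] -/
theorem modelχq'_exists_cyclotomeMod_family {l : ℕ} (hl : 0 < l) :
    ∃ mods : ∀ N : ℕ+, (ThetaSetting.modelχq' p i j hj).CyclotomeMod l N,
      ∀ (M M' : ℕ+) (h : (M : ℕ) ∣ (M' : ℕ)) (x : ↥((ThetaSetting.modelχq' p i j hj).lDeltaTheta l)),
        MuN.red p M M' h ((mods M').red x) = (mods M).red x := by
  haveI := t2Space_deltaTheta_modelχq' p i j hj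
  -- `(modelχq′).DeltaTheta` is DEFINITIONALLY `Ker (CurveTheta.thetaToEll (curveχq p i j))` (same `Π^tp_X`, same
  -- theta-quotient kernels: `thetaKer_curveχq'_eq` is `rfl`), so abc-iut-L6-d6's coordinates and their χ-law at
  -- `modelχq` are accepted verbatim by unification (no instance search on mixed carriers).
  exact (ThetaSetting.modelχq' p i j hj).exists_cyclotomeMod_family_of_chiTwist_inv hl (deltaThetaCoordχq p i j)
    (continuous_deltaThetaCoordχq p i j) (bijective_deltaThetaCoordχq p i j)
    (fun g t => conjNormal_toTheta_deltaThetaCoordχq p i j hj g t)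

/-- **`CyclotomeMod l N` is INHABITED at `modelχq′`** (every `l ≥ 1`, every `N`). [cite: MochizukiEtTh2009, §2 p.46] -/
theorem modelχq'_nonempty_cyclotomeMod {l : ℕ} (hl : 0 < l) (N : ℕ+) :
    Nonempty ((ThetaSetting.modelχq' p i j hj).CyclotomeMod l N) := by
  obtain ⟨mods, -⟩ := modelχq'_exists_cyclotomeMod_family p i j hj hl
  exact ⟨mods N⟩

/-- **A `CyclotomeTower l E` EXISTS at `modelχq′`** over every cofinal chain `E ∋ 1` (`l ≥ 1`).
[cite: MochizukiEtTh2009, Cor 2.19 (ii) p.64] -/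
theorem modelχq'_nonempty_cyclotomeTower {l : ℕ} (hl : 0 < l) {E : Set ℕ+} (one_mem : (1 : ℕ+) ∈ E)
    (cofinal : ∀ n : ℕ+, ∃ M ∈ E, n ∣ M) (total : ∀ M ∈ E, ∀ M' ∈ E, M ∣ M' ∨ M' ∣ M) :
    Nonempty ((ThetaSetting.modelχq' p i j hj).CyclotomeTower l E) := by
  obtain ⟨mods, hmods⟩ := modelχq'_exists_cyclotomeMod_family p i j hj hl
  exact ⟨ThetaSetting.CyclotomeTower.ofAllLevels mods hmods one_mem cofinal total⟩

end

/-- **JOINT SATISFIABILITY WITH A CUSP at stage 2**: for every `(i, j)` with `j` even there is a theta setting OVER THE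
CUSPED STAGE-2 CARRIER `curveχq′ p i j` which is an EtTh-origin, HAS A CUSP, satisfies `hYcl`, has `Δ_Θ` compact and `aug`
open, and carries `CyclotomeMod l N` at every level and a `CyclotomeTower l E` over every cofinal chain `E ∋ 1` (`l ≥ 1`).
[cite: MochizukiEtTh2009, Cor 2.19 (ii) p.64] -/
theorem exists_curveχq'_isEtThOrigin_and_isCusp_and_hYcl_and_isCompact_and_cyclotomeTower (i j : ℤ) (hj : Even j)
    {l : ℕ} (hl : 0 < l) {E : Set ℕ+} (one_mem : (1 : ℕ+) ∈ E) (cofinal : ∀ n : ℕ+, ∃ M ∈ E, n ∣ M)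
    (total : ∀ M ∈ E, ∀ M' ∈ E, M ∣ M' ∨ M' ∣ M) :
    ∃ D : ThetaSetting p, D.toTemperedCurve = curveχq' p i j ∧ D.IsEtThOrigin ∧ (∃ x : D.Pt, D.IsCusp x) ∧
      (D.DtpY.map D.toHat.toMonoidHom).topologicalClosure ≤
        D.DtpY.map D.toHat.toMonoidHom ⊔ (⁅⁅D.DeltaHat, D.DeltaHat⁆, D.DeltaHat⁆).topologicalClosure ∧
      IsCompact (D.DeltaTheta : Set D.GtpTheta) ∧ IsOpenMap D.aug ∧
      (∀ N : ℕ+, Nonempty (D.CyclotomeMod l N)) ∧ Nonempty (D.CyclotomeTower l E) :=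
  ⟨ThetaSetting.modelχq' p i j hj, rfl, ThetaSetting.modelχq'_isEtThOrigin p i j hj, exists_isCusp_modelχq' p i j hj,
    hYcl_modelχq' p i j hj, isCompact_deltaTheta_modelχq' p i j hj, isOpenMap_aug_modelχq' p i j hj,
    modelχq'_nonempty_cyclotomeMod p i j hj hl, modelχq'_nonempty_cyclotomeTower p i j hj hl one_mem cofinal total⟩

end Literature.AnabelianGeometry.EtaleTheta.SettingModel

end
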